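/-
Copyright (c) 2026. All rights reserved.
Released under Apache 2.0 license as described in the file LICENSE.
Authors: abc-iut cell — seat abc-iut-w5-d053 (gen 3; co-split (I) of abc-iut-L4-t5's row «Cor36-CROSS», offered
08:30Z, unrefused).
-/
import Literature.AnabelianGeometry.AbsoluteAnabelian.AbsTopIII.FrobeniusPictureMLFLogGlueFamily

/-!
# [AbsTopIII] Cor 3.6 (iii): the cross-term gluing identity EXTENDED from generator pairs over `Sat(LogGen)`

S. Mochizuki, *Topics in Absolute Anabelian Geometry III*, Cor. 3.6 (iii) pp. 80–81, Def. 3.5 (ii) p. 75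
(`MochizukiAbsTopIII2015`).  PROOF-ONLY file (no definition).

`FrobeniusPictureMLFLogGlueFamily.lean` (abc-iut-w5-d053, p431675) reduces the cores clause `LogObsCompatCoresStmt`
to the cross-term identity; `FrobeniusPictureMLFLogGlueCrossAdapter.lean` (p432316) reduces that to its IMAGE FORM
`himg` (pairs `(p, q) ∈ E_{H₃} = Sat(LogGen)`, pre-whiskered by `embLog[r]`, post-whiskered by `r₂` into a core
vertex).  THIS file is the FORMAL half (I) of abc-iut-L4-t5's «Cor36-CROSS» plan: the image-form identity for ALL
of `Sat(LogGen)` follows from the identity for the GENERATOR pairs alone (types (1)/(2) of Cor. 3.6 (iii)) —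
`imageCross_of_generators`, by induction on `Saturation`: identity pairs (`glueη_refl`, `pushLogη_refl`),
composites (`glueη_trans`, `pushLogη_trans`; the targets are `𝒩` by `IsLogObservableFamily`), pre-whiskered pairs
(`pushLogη_precomp`, re-indexing `r ↦ r ∘ r'`), post-whiskered pairs (`pushLogη_postcomp` — proved here from the
`𝔖_log` family's whisker law read on `𝒟` — and `r₂ ↦ embLog[r'] ∘ r₂`); every `eqToHom` computation is a generic
lemma applied by `exact`.  Its conclusion is LITERALLY the `himg` binder of `logObsCompatCoresStmt_of_imageCross`
(p432316), so the cores clause of Cor. 3.6 (iii) now waits on the generator identity `hbase` only (the other half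
(G) of «Cor36-CROSS»: `IotaOverGaloisStmt` + `LogPinned` through `lift_ext` over `ℰ`, abc-iut-L4-t5).
HONEST SCOPE: nothing of (G) is proved here; no claim of the paper is asserted; nothing bears on [IUTchIII]
Cor. 3.12; typed ≠ discharged.
-/

namespace Literature.AnabelianGeometry.AbsoluteAnabelian

open _root_.CategoryTheory _root_.Quiver

universe u

namespace LogFrobeniusData

open DiagramOfCategories

variable (Δ : LogFrobeniusData.{u})

/-! ### §5 (abc-iut-w5-d053): the image-form cross identity EXTENDED from generator pairs over `Sat(LogGen)` -/

/-- `eqToHom` bookkeeping for the right half of the whisker law with trivial left whisker (generic; applied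
by `exact`). [folklore] -/
private theorem whisker_nil_left_sandwich {A B C : Type*} [Category A] [Category B] [Category C]
    {F₁ F₂ : B ⥤ C} (hF : F₁ = F₂) {G G' H H' : A ⥤ B} (hG : G' = G) (hH : H = H') (η : G ⟶ H)
    {I : A ⥤ A} (hI : I = 𝟭 A) {X M₀ M₁ N₁ N₀ Y : A ⥤ C}
    (eA : X = M₀) (eC : M₀ = M₁) (eE : M₁ = I ⋙ (G ⋙ F₁)) (eF : I ⋙ (H ⋙ F₁) = N₁) (eD : N₁ = N₀)
    (eB : N₀ = Y) (e₅ : X = G' ⋙ F₂) (e₆ : H' ⋙ F₂ = Y) :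
    eqToHom eA ≫ (eqToHom eC ≫ (eqToHom eE ≫ Functor.whiskerLeft I (Functor.whiskerRight η F₁) ≫
      eqToHom eF) ≫ eqToHom eD) ≫ eqToHom eB =
      eqToHom e₅ ≫ Functor.whiskerRight (eqToHom hG ≫ η ≫ eqToHom hH) F₂ ≫ eqToHom e₆ := by
  subst hF hG hH hI eA eC eE eF eD eB
  ext x
  simp
  all_goals first
    | rfl
    | exact (conj_eqToHom_iff_heq' _ _ _ _).mpr HEq.rfl

/-- **The pushed-forward `𝔖_log` homotopy, post-whiskered** (Def. 3.5 (ii) whisker law on `𝒟_{≤3}`, right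
half, read on `𝒟`): for `r' : b₀ → b₁` and `(p, q) ∈ E_{H₃}`, `ζ_{(p∘r', q∘r')} = ζ_{(p,q)} ▷ 𝒟_{r'}` up to
the `eqToHom`s of `pathFunctor_comp`. [cite: MochizukiAbsTopIII2015, Definition 3.5 (ii) p.75] -/
theorem pushLogη_postcomp (H₃ : Δ.sub3.HomotopyFamily) {a₀ b₀ b₁ : logObsShape.{u}.Vertex}
    {p q : Path a₀ b₀} (h : H₃.E p q) (r' : Path b₀ b₁) :
    Δ.pushLogη H₃ (H₃.isSaturated.postcomp h r') =
      eqToHom (by rw [Prefunctor.mapPath_comp, pathFunctor_comp]) ≫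
        Functor.whiskerRight (Δ.pushLogη H₃ h) (Δ.diagram.pathFunctor (embLog.mapPath r')) ≫
        eqToHom (by rw [Prefunctor.mapPath_comp, pathFunctor_comp]) := by
  unfold pushLogη
  have hw := (Δ.sub3_eq_comapAlong ▸ H₃).η_whisker
    ((HomotopyFamily.cast_E_iff Δ.sub3_eq_comapAlong H₃ p q).mpr h) Path.nil r'
  have hc := HomotopyFamily.η_congr (Δ.sub3_eq_comapAlong ▸ H₃) (Path.nil_comp (p.comp r')).symm
    (Path.nil_comp (q.comp r')).symm
    ((HomotopyFamily.cast_E_iff Δ.sub3_eq_comapAlong H₃ (p.comp r') (q.comp r')).mpr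
      (H₃.isSaturated.postcomp h r'))
  rw [hc]
  erw [hw]
  exact whisker_nil_left_sandwich (Δ.diagram.pathFunctor_comapAlong embLog r') _ _ _
    ((Δ.diagram.comapAlong embLog).pathFunctor_nil a₀) _ _ _ _ _ _ _ _

/-- Generic: the whiskered sandwich of an identity 2-cell is the identity. [folklore] -/
private theorem sandwich_whisker_id {A B C C' : Type*} [Category A] [Category B] [Category C] [Category C']
    {F : A ⥤ B} {G : B ⥤ C} {I : C ⥤ C'} {X : A ⥤ C'} (e₁ : X = F ⋙ (G ⋙ I)) (e₂ : F ⋙ (G ⋙ I) = X) :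
    𝟙 X = eqToHom e₁ ≫ Functor.whiskerLeft F (Functor.whiskerRight (𝟙 G) I) ≫ eqToHom e₂ := by
  subst e₁
  simp

/-- Generic: composing two whiskered sandwiches. [folklore] -/
private theorem sandwich_whisker_comp {A B C C' : Type*} [Category A] [Category B] [Category C]
    [Category C'] {F : A ⥤ B} {G₁ G₂ G₃ : B ⥤ C} (η₁ : G₁ ⟶ G₂) (η₂ : G₂ ⟶ G₃) {I : C ⥤ C'}
    {X M Y : A ⥤ C'} (eX : X = F ⋙ (G₁ ⋙ I)) (eZ : F ⋙ (G₂ ⋙ I) = M) (eZ' : M = F ⋙ (G₂ ⋙ I))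
    (eY : F ⋙ (G₃ ⋙ I) = Y) :
    (eqToHom eX ≫ Functor.whiskerLeft F (Functor.whiskerRight η₁ I) ≫ eqToHom eZ) ≫
        (eqToHom eZ' ≫ Functor.whiskerLeft F (Functor.whiskerRight η₂ I) ≫ eqToHom eY) =
      eqToHom eX ≫ Functor.whiskerLeft F (Functor.whiskerRight (η₁ ≫ η₂) I) ≫ eqToHom eY := by
  subst eX eZ eY
  simp

/-- Generic: the whiskered sandwich of a pre-whiskered sandwich, re-indexed (precomposition step of the
induction). [folklore] -/
private theorem sandwich_whisker_precomp {A B B' C C' : Type*} [Category A] [Category B] [Category B']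
    [Category C] [Category C'] (F : A ⥤ B) (F₂ : B ⥤ B') {F' : A ⥤ B'} (hF : F' = F ⋙ F₂) {G H : B' ⥤ C}
    (η : G ⟶ H) (I : C ⥤ C') {G₂ H₂ : B ⥤ C} (c : G₂ = F₂ ⋙ G) (d : F₂ ⋙ H = H₂) {X X' Y' Y : A ⥤ C'}
    (a : X = X') (eX' : X' = F' ⋙ (G ⋙ I)) (eY' : F' ⋙ (H ⋙ I) = Y') (b : Y' = Y)
    (eX : X = F ⋙ (G₂ ⋙ I)) (eY : F ⋙ (H₂ ⋙ I) = Y) :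
    eqToHom a ≫ (eqToHom eX' ≫ Functor.whiskerLeft F' (Functor.whiskerRight η I) ≫ eqToHom eY') ≫
        eqToHom b =
      eqToHom eX ≫ Functor.whiskerLeft F
        (Functor.whiskerRight (eqToHom c ≫ Functor.whiskerLeft F₂ η ≫ eqToHom d) I) ≫ eqToHom eY := by
  subst hF c d a b eX' eY'
  ext x
  simp
  all_goals first
    | rfl
    | exact (conj_eqToHom_iff_heq' _ _ _ _).mpr HEq.rfl

/-- Generic: the whiskered sandwich of a post-whiskered sandwich, re-indexed (postcomposition step of the
induction). [folklore] -/
private theorem sandwich_whisker_postcomp {A B C C₁ C' : Type*} [Category A] [Category B] [Category C]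
    [Category C₁] [Category C'] (F : A ⥤ B) {G H : B ⥤ C} (η : G ⟶ H) (J : C ⥤ C₁) (I : C₁ ⥤ C')
    {I' : C ⥤ C'} (hI : I' = J ⋙ I) {G₂ H₂ : B ⥤ C₁} (c : G₂ = G ⋙ J)
    (d' : H ⋙ J = H₂) {X X' Y' Y : A ⥤ C'}
    (a : X = X') (eX' : X' = F ⋙ (G ⋙ I')) (eY' : F ⋙ (H ⋙ I') = Y') (b : Y' = Y)
    (eX : X = F ⋙ (G₂ ⋙ I)) (eY : F ⋙ (H₂ ⋙ I) = Y) :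
    eqToHom a ≫ (eqToHom eX' ≫ Functor.whiskerLeft F (Functor.whiskerRight η I') ≫ eqToHom eY') ≫
        eqToHom b =
      eqToHom eX ≫ Functor.whiskerLeft F
        (Functor.whiskerRight (eqToHom c ≫ Functor.whiskerRight η J ≫ eqToHom d') I) ≫ eqToHom eY := by
  subst hI c d' a b eX' eY'
  ext x
  simp
  all_goals
    repeat erw [Category.id_comp]
    all_goals erw [eqToHom_refl, Category.comp_id]

variable {Δ} in
/-- **The image-form cross identity EXTENDS from generator pairs over `Sat(LogGen)`** (the formal half of
«Cor36-CROSS»): if, for every GENERATOR pair `(p, q) ∈ LogGen` (types (1)/(2) of Cor. 3.6 (iii)), every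
pre-whisker `r` and every post-whisker `r₂` into a core vertex, the glued (= universal-over-`ℰ`) homotopy of
the image pair is `𝒟_{embLog[r]} ◁ (pushLogη (p,q) ▷ 𝒟_{r₂})`, then the same holds for every pair of
`E_{H₃} = Sat(LogGen)`.  Induction on `Saturation`: identity pairs by `glueη_refl` / `pushLogη_refl`, composites
by `glueη_trans` / `pushLogη_trans` (targets are `𝒩` by `IsLogObservableFamily`), pre- and post-whiskered pairs by
`pushLogη_precomp` / `pushLogη_postcomp` and re-indexing. [cite: MochizukiAbsTopIII2015, Corollary 3.6 (iii) p.81] -/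
theorem imageCross_of_generators {H₃ : Δ.sub3.HomotopyFamily} (hH₃ : Δ.IsLogObservableFamily H₃)
    (hbase : ∀ ⦃c₀ a₀ b₀ : logObsShape.{u}.Vertex⦄ (r : Path c₀ a₀) (p q : Path a₀ b₀) (hg : Δ.LogGen p q)
      ⦃d : LFVertex⦄ (r₂ : Path (embLog.obj b₀) d), coreVertices d →
      ∀ h' : Δ.GlueE ((embLog.mapPath r).comp ((embLog.mapPath p).comp r₂))
          ((embLog.mapPath r).comp ((embLog.mapPath q).comp r₂)),
        Δ.glueη H₃ hH₃.1 h' =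
          eqToHom (by rw [pathFunctor_comp, pathFunctor_comp]) ≫
            Functor.whiskerLeft (Δ.diagram.pathFunctor (embLog.mapPath r))
              (Functor.whiskerRight (Δ.pushLogη H₃ ((hH₃.1 p q).mpr (Saturation.base hg)))
                (Δ.diagram.pathFunctor r₂)) ≫
            eqToHom (by rw [pathFunctor_comp, pathFunctor_comp]))
    ⦃a₀ b₀ : logObsShape.{u}.Vertex⦄ ⦃p q : Path a₀ b₀⦄ (hs : Saturation Δ.LogGen p q) :
    ∀ ⦃c₀ : logObsShape.{u}.Vertex⦄ (r : Path c₀ a₀) (hh : H₃.E p q) ⦃d : LFVertex⦄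
      (r₂ : Path (embLog.obj b₀) d), coreVertices d →
      ∀ h' : Δ.GlueE ((embLog.mapPath r).comp ((embLog.mapPath p).comp r₂))
          ((embLog.mapPath r).comp ((embLog.mapPath q).comp r₂)),
        Δ.glueη H₃ hH₃.1 h' =
          eqToHom (by rw [pathFunctor_comp, pathFunctor_comp]) ≫
            Functor.whiskerLeft (Δ.diagram.pathFunctor (embLog.mapPath r))
              (Functor.whiskerRight (Δ.pushLogη H₃ hh) (Δ.diagram.pathFunctor r₂)) ≫
            eqToHom (by rw [pathFunctor_comp, pathFunctor_comp]) := by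
  induction hs with
  | base hg =>
    intro c₀ r hh d r₂ hd h'
    exact hbase r _ _ hg r₂ hd h'
  | refl_left _ _ =>
    intro c₀ r hh d r₂ hd h'
    rw [Δ.glueη_refl H₃ hH₃.1 h', Δ.pushLogη_refl H₃ hh]
    exact sandwich_whisker_id _ _
  | refl_right _ _ =>
    intro c₀ r hh d r₂ hd h'
    rw [Δ.glueη_refl H₃ hH₃.1 h', Δ.pushLogη_refl H₃ hh]
    exact sandwich_whisker_id _ _
  | trans hs₁ hs₂ ih₁ ih₂ =>
    rename_i a b p' q' r'
    intro c₀ r hh d r₂ hd h'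
    have hh₁ : H₃.E p' q' := (hH₃.1 _ _).mpr hs₁
    have hh₂ : H₃.E q' r' := (hH₃.1 _ _).mpr hs₂
    have hb : b = lvObs := hH₃.2.1 hh₁
    subst hb
    have g₁ : Δ.GlueE ((embLog.mapPath r).comp ((embLog.mapPath p').comp r₂))
        ((embLog.mapPath r).comp ((embLog.mapPath q').comp r₂)) :=
      Δ.isSaturated_glueE.precomp
        (Δ.isSaturated_glueE.postcomp (Δ.glueE_mapPath_of_logE H₃ hH₃.1 p' q' hh₁) r₂) _
    have g₂ : Δ.GlueE ((embLog.mapPath r).comp ((embLog.mapPath q').comp r₂))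
        ((embLog.mapPath r).comp ((embLog.mapPath r').comp r₂)) :=
      Δ.isSaturated_glueE.precomp
        (Δ.isSaturated_glueE.postcomp (Δ.glueE_mapPath_of_logE H₃ hH₃.1 q' r' hh₂) r₂) _
    rw [show Δ.glueη H₃ hH₃.1 h' = Δ.glueη H₃ hH₃.1 (Δ.isSaturated_glueE.trans g₁ g₂) from rfl,
      Δ.glueη_trans H₃ hH₃.1 g₁ g₂, ih₁ r hh₁ r₂ hd g₁, ih₂ r hh₂ r₂ hd g₂,
      show Δ.pushLogη H₃ hh = Δ.pushLogη H₃ (H₃.isSaturated.trans hh₁ hh₂) from rfl,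
      Δ.pushLogη_trans H₃ hh₁ hh₂]
    exact sandwich_whisker_comp _ _ _ _ _ _
  | precomp r' hs ih =>
    rename_i a b c p' q'
    intro c₀ r hh d r₂ hd h'
    have e : ∀ x : Path a b, (embLog.mapPath r).comp ((embLog.mapPath (r'.comp x)).comp r₂) =
        (embLog.mapPath (r.comp r')).comp ((embLog.mapPath x).comp r₂) := by
      intro x
      rw [Prefunctor.mapPath_comp, Prefunctor.mapPath_comp, Path.comp_assoc, Path.comp_assoc]
    have hh₀ : H₃.E p' q' := (hH₃.1 _ _).mpr hs
    have g : Δ.GlueE ((embLog.mapPath (r.comp r')).comp ((embLog.mapPath p').comp r₂))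
        ((embLog.mapPath (r.comp r')).comp ((embLog.mapPath q').comp r₂)) := by
      rw [← e p', ← e q']
      exact h'
    rw [Δ.glueη_congr H₃ hH₃.1 (e p') (e q') h' g, ih (r.comp r') hh₀ r₂ hd g,
      show Δ.pushLogη H₃ hh = Δ.pushLogη H₃ (H₃.isSaturated.precomp hh₀ r') from rfl,
      Δ.pushLogη_precomp H₃ r' hh₀]
    exact sandwich_whisker_precomp (Δ.diagram.pathFunctor (embLog.mapPath r))
      (Δ.diagram.pathFunctor (embLog.mapPath r')) (by rw [Prefunctor.mapPath_comp, pathFunctor_comp])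
      _ _ _ _ _ _ _ _ _ _
  | postcomp r' hs ih =>
    rename_i a b c p' q'
    intro c₀ r hh d r₂ hd h'
    have e : ∀ x : Path a b, (embLog.mapPath r).comp ((embLog.mapPath (x.comp r')).comp r₂) =
        (embLog.mapPath r).comp ((embLog.mapPath x).comp ((embLog.mapPath r').comp r₂)) := by
      intro x
      rw [Prefunctor.mapPath_comp, Path.comp_assoc]
    have hh₀ : H₃.E p' q' := (hH₃.1 _ _).mpr hs
    have g : Δ.GlueE ((embLog.mapPath r).comp ((embLog.mapPath p').comp ((embLog.mapPath r').comp r₂)))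
        ((embLog.mapPath r).comp ((embLog.mapPath q').comp ((embLog.mapPath r').comp r₂))) := by
      rw [← e p', ← e q']
      exact h'
    rw [Δ.glueη_congr H₃ hH₃.1 (e p') (e q') h' g, ih r hh₀ ((embLog.mapPath r').comp r₂) hd g,
      show Δ.pushLogη H₃ hh = Δ.pushLogη H₃ (H₃.isSaturated.postcomp hh₀ r') from rfl,
      Δ.pushLogη_postcomp H₃ hh₀ r']
    exact sandwich_whisker_postcomp (Δ.diagram.pathFunctor (embLog.mapPath r)) _
      (Δ.diagram.pathFunctor (embLog.mapPath r')) (Δ.diagram.pathFunctor r₂) (by rw [pathFunctor_comp])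
      _ _ _ _ _ _ _ _

end LogFrobeniusData

end Literature.AnabelianGeometry.AbsoluteAnabelian
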